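import Summits.QuantumFields.BalabanUV.T4Continuum.Support.NE7MinimalActionDifferentiable
import Summits.QuantumFields.BalabanUV.T4Continuum.Support.NE7CovariantConstancyBox
import Summits.QuantumFields.BalabanUV.T4Continuum.Support.NE7GaugeActionChart
import HarnessLib

/-!
# NE7GaugeSliceMapFacts — THE CONCRETE FACTS ABOUT THE SLICE MAP `A(ζ, Φ) = skewPR M (relLog M W ((chart_W Φ)^{exp ζ}))` needed to instantiate the abstract local slice theorem
# (✓ p823307 `NE7LocalSlice.local_slice`) in the C¹ rung (ROAD-G114 §9 (S1)): (a) the trivial gauge acts trivially: `A(0, Φ) = Φ`; (b) decoding: `chart_W (A(ζ,Φ)) = (chart_W Φ)^{exp ζ}`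
# when the gauged configuration is bondwise near `W`; (c) EXACT DATA INVARIANCE for trivial-corner `ζ`: the `(j+1)`-fold average of `(chart_W Φ)^{exp ζ}` is that of `chart_W Φ`, hence
# `Q̄(A(ζ,Φ)) = Q̄(Φ)`; (d) the linearised action `ζ̇ ↦ ∇̃_W ζ̇` (✓ p823279 `fderiv_gaugeChart_apply`) is INJECTIVE on trivial-corner fields (✓ p823450 `eq_zero_of_covariantly_constant`)

Cell `pub-balaban`, rung (B)+1 sub-cell t4, lineage `b2b-balaban-t4-ne7-p1` (CRUX PROVER NE7 #1 = OWNER of BINDER row NE7), generation 114.  Memo `t4/b2b-balaban-t4-ne7-p1-g114/ROAD-G114.md` §9.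
WHAT ([folklore]; 0 def, 0 sorry; `d = 4`).  `expGauge_isUnitarySite`, `expGauge_isPeriodicSite`, `sliceMap_zero_gauge`, `chart_sliceMap`, `avgIter_gaugeAct_trivialCorner`, `levelQ_sliceMap`,
**`covDeriv_injective_trivialCorner`**.
HONEST FRAMING (page 1): bookkeeping over landed kernel theorems; nothing of Bałaban's; NOT NE7, NOT NE3; spine 0∕9; finite T⁴ rung (B)+1 — NOT infinite volume, NOT mass gap, NOT BetaPertH, NOT Clay.
-/

set_option autoImplicit false

open scoped BigOperators Matrix Matrix.Norms.L2Operator Topology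
open NormedSpace Finset Set Filter

namespace Summit.QuantumFields.BalabanUV.T4Continuum.NE7GaugeSliceMapFacts

open Literature.MathematicalPhysics.QuantumFieldTheory.Balaban1983to89
open B7Prop1Explicit B7Prop2Explicit MatrixLog
open T4AveragingDeficitWall (IsUnitaryCfg IsSkewDir SmallField expUnit_zero)
open T4AveragingDeficitWallBoundary (IsPeriodicCfg)
open AveragingDeficitTorusChart (TDir chart chartDir redN redN_boxVec redN_add_smul isPeriodicCfg_chart isUnitaryCfg_chart)
open AveragingDeficitChartCalculus (relLog)
open AveragingDeficitTwoLevelPrep (skewSub skewPR)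
open AveragingDeficitMultiLevelPrep (tower levelQ cavgIter LevelSmall)
open AveragingDeficitMultiLevelBridge (cavgIter_eq_avgIter)
open AveragingDeficitKDatum (isUnitaryCfg_gaugeAct)
open MinimalActionRate (sfClass)
open NE3EnergyShapes (IsUnitarySite IsPeriodicSite gaugeAct_one)
open NE3ResidualSliceRep (isPeriodicCfg_gaugeAct)
open NE7AdmissibleFibreLHC (chart_id_eq_chart_skewP)
open NE7TorusChartDecoding (chart_skewPR_relLog_eq)
open NE7EtaMinimiserGaugeCovariance (avgIter_gaugeAct_sfClass)
open NE7MinimalActionDifferentiable (skewPR_relLog_chart_self)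
open NE7CovariantConstancyBox (eq_zero_of_covariantly_constant)

noncomputable section

variable {n : Type} [Fintype n] [DecidableEq n]

/-! ## §1 The exponential gauge of a box site field -/

/-- The gauge `x ↦ e^{ζ(x mod M)}` of a skew box field is unitary. [folklore] -/
theorem expGauge_isUnitarySite {M : ℕ} [NeZero M] {ζ : (Fin 4 → Fin M) → Matrix n n ℂ} (hζ : ∀ r, ζ r ∈ skewAdjoint (Matrix n n ℂ)) :
    IsUnitarySite (fun x : Site 4 => expUnit (ζ (redN M x))) := by
  intro x
  letI : NormedAlgebra ℚ (Matrix n n ℂ) := NormedAlgebra.restrictScalars ℚ ℂ (Matrix n n ℂ)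
  exact mem_unitaryUnits.mpr (by rw [val_expUnit]; exact NormedSpace.exp_mem_unitary_of_mem_skewAdjoint (hζ _))

/-- The gauge `x ↦ e^{ζ(x mod M)}` is `M`-periodic. [folklore] -/
theorem expGauge_isPeriodicSite {M : ℕ} [NeZero M] (ζ : (Fin 4 → Fin M) → Matrix n n ℂ) :
    IsPeriodicSite (fun x : Site 4 => expUnit (ζ (redN M x))) (M : ℤ) := by
  intro x i
  show expUnit (ζ (redN M (x + (M : ℤ) • e i))) = expUnit (ζ (redN M x))
  rw [redN_add_smul]

/-- The zero field gives the trivial gauge. [folklore] -/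
theorem expGauge_zero (M : ℕ) [NeZero M] : (fun x : Site 4 => expUnit ((0 : (Fin 4 → Fin M) → Matrix n n ℂ) (redN M x))) = fun _ => (1 : (Matrix n n ℂ)ˣ) := by
  funext x; simp only [Pi.zero_apply, expUnit_zero]

/-! ## §2 (a) The trivial gauge acts trivially; (b) decoding -/

/-- **(a)** `A(0, Φ) = Φ` for `‖Φ‖ < log 2`. [folklore] -/
theorem sliceMap_zero_gauge [Nonempty n] {M : ℕ} [NeZero M] (W : Site 4 → Fin 4 → (Matrix n n ℂ)ˣ) (Φ : ↥(skewSub 4 n M)) (hΦ : ‖Φ‖ < Real.log 2) :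
    skewPR M (relLog M W (gaugeAct (fun x : Site 4 => expUnit ((0 : (Fin 4 → Fin M) → Matrix n n ℂ) (redN M x)))
      (chart (ContinuousLinearMap.id ℝ (Matrix n n ℂ)) M W (Φ : TDir 4 n M)))) = Φ := by
  rw [expGauge_zero, gaugeAct_one]
  exact skewPR_relLog_chart_self W Φ hΦ

/-- **(b) DECODING**: if `(chart_W Φ)^{exp ζ}` is bondwise within `1∕4` of the unitary `M`-periodic `W` (relative), then `chart_W (A(ζ, Φ)) = (chart_W Φ)^{exp ζ}`. [folklore] -/
theorem chart_sliceMap [Nonempty n] {M : ℕ} [NeZero M] {W : Site 4 → Fin 4 → (Matrix n n ℂ)ˣ} (hWu : IsUnitaryCfg W) (hWP : IsPeriodicCfg W (M : ℤ))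
    {ζ : (Fin 4 → Fin M) → Matrix n n ℂ} (hζ : ∀ r, ζ r ∈ skewAdjoint (Matrix n n ℂ)) (Φ : ↥(skewSub 4 n M))
    (hnear : ∀ (r : Fin 4 → Fin M) (κ : Fin 4), ‖(((W (boxVec M r) κ)⁻¹ : (Matrix n n ℂ)ˣ) : Matrix n n ℂ)
      * ((gaugeAct (fun x : Site 4 => expUnit (ζ (redN M x))) (chart (ContinuousLinearMap.id ℝ (Matrix n n ℂ)) M W (Φ : TDir 4 n M)) (boxVec M r) κ : (Matrix n n ℂ)ˣ) : Matrix n n ℂ)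
        - 1‖ ≤ 1 / 4) :
    chart (ContinuousLinearMap.id ℝ (Matrix n n ℂ)) M W
        ((skewPR M (relLog M W (gaugeAct (fun x : Site 4 => expUnit (ζ (redN M x))) (chart (ContinuousLinearMap.id ℝ (Matrix n n ℂ)) M W (Φ : TDir 4 n M)))) : ↥(skewSub 4 n M)) :
          TDir 4 n M)
      = gaugeAct (fun x : Site 4 => expUnit (ζ (redN M x))) (chart (ContinuousLinearMap.id ℝ (Matrix n n ℂ)) M W (Φ : TDir 4 n M)) := by
  have hchu : IsUnitaryCfg (chart (ContinuousLinearMap.id ℝ (Matrix n n ℂ)) M W (Φ : TDir 4 n M)) := by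
    rw [chart_id_eq_chart_skewP W Φ.2]; exact isUnitaryCfg_chart M hWu _
  have hchP : IsPeriodicCfg (chart (ContinuousLinearMap.id ℝ (Matrix n n ℂ)) M W (Φ : TDir 4 n M)) (M : ℤ) := isPeriodicCfg_chart _ M hWP _
  have hgu := expGauge_isUnitarySite (n := n) hζ
  have hgP := expGauge_isPeriodicSite (n := n) ζ
  exact chart_skewPR_relLog_eq hWu (isUnitaryCfg_gaugeAct hgu hchu) hWP (isPeriodicCfg_gaugeAct hgP hchP) hnear

/-! ## §3 (c) Exact data invariance for trivial-corner gauges -/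

/-- **(c) TRIVIAL-CORNER GAUGES PRESERVE THE `(j+1)`-FOLD AVERAGE**: for `U ∈ sfClass 4 L N ε (j+1)` and a box field `ζ` on `[0, L·tower L N j)^4` vanishing at the corner indices
`redN M (L^{j+1}•w)`, `avgIter L (U^{exp ζ}) (j+1) = avgIter L U (j+1)`. [folklore] -/
theorem avgIter_gaugeAct_trivialCorner [Nonempty n] {L N : ℕ} [NeZero L] [NeZero N] (hL : 1 ≤ L) {ε : ℝ} (hε : 0 ≤ ε) (j : ℕ)
    (hs : LevelSmall 4 L j (ε / ((L : ℝ) ^ (j + 1)) ^ 2)) {U : Site 4 → Fin 4 → (Matrix n n ℂ)ˣ} (hU : U ∈ sfClass 4 L N ε (j + 1))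
    {ζ : (Fin 4 → Fin (L * tower L N j)) → Matrix n n ℂ} (hζ : ∀ r, ζ r ∈ skewAdjoint (Matrix n n ℂ))
    (hcorner : ∀ w : Site 4, ζ (redN (L * tower L N j) (((L : ℤ) ^ (j + 1)) • w)) = 0) :
    avgIter L (gaugeAct (fun x : Site 4 => expUnit (ζ (redN (L * tower L N j) x))) U) (j + 1) = avgIter L U (j + 1) := by
  rw [avgIter_gaugeAct_sfClass hL hε j hs hU (expGauge_isUnitarySite (n := n) hζ)]
  have hc : (fun w : Site 4 => expUnit (ζ (redN (L * tower L N j) (((L : ℤ) ^ (j + 1)) • w)))) = fun _ => (1 : (Matrix n n ℂ)ˣ) := by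
    funext w; rw [hcorner, expUnit_zero]
  rw [hc, gaugeAct_one]

/-- **(c′) `Q̄(A(ζ, Φ)) = Q̄(Φ)`** for trivial-corner `ζ` (with (b)'s decoding hypothesis and `chart_{U♯} Φ` in the class). [folklore] -/
theorem levelQ_sliceMap [Nonempty n] {L N : ℕ} [NeZero L] [NeZero N] (hL : 1 ≤ L) {ε : ℝ} (hε : 0 ≤ ε) (j : ℕ)
    (hs : LevelSmall 4 L j (ε / ((L : ℝ) ^ (j + 1)) ^ 2)) {Us : Site 4 → Fin 4 → (Matrix n n ℂ)ˣ} (hUsu : IsUnitaryCfg Us) (hUsP : IsPeriodicCfg Us ((L * tower L N j : ℕ) : ℤ))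
    {ζ : (Fin 4 → Fin (L * tower L N j)) → Matrix n n ℂ} (hζ : ∀ r, ζ r ∈ skewAdjoint (Matrix n n ℂ))
    (hcorner : ∀ w : Site 4, ζ (redN (L * tower L N j) (((L : ℤ) ^ (j + 1)) • w)) = 0) (Φ : ↥(skewSub 4 n (L * tower L N j)))
    (hΦcl : chart (ContinuousLinearMap.id ℝ (Matrix n n ℂ)) (L * tower L N j) Us (Φ : TDir 4 n (L * tower L N j)) ∈ sfClass 4 L N ε (j + 1))
    (hnear : ∀ (r : Fin 4 → Fin (L * tower L N j)) (κ : Fin 4), ‖(((Us (boxVec (L * tower L N j) r) κ)⁻¹ : (Matrix n n ℂ)ˣ) : Matrix n n ℂ)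
      * ((gaugeAct (fun x : Site 4 => expUnit (ζ (redN (L * tower L N j) x))) (chart (ContinuousLinearMap.id ℝ (Matrix n n ℂ)) (L * tower L N j) Us (Φ : TDir 4 n (L * tower L N j)))
          (boxVec (L * tower L N j) r) κ : (Matrix n n ℂ)ˣ) : Matrix n n ℂ) - 1‖ ≤ 1 / 4) :
    levelQ L N j Us (chart (ContinuousLinearMap.id ℝ (Matrix n n ℂ)) (L * tower L N j) Us
        ((skewPR (L * tower L N j) (relLog (L * tower L N j) Us (gaugeAct (fun x : Site 4 => expUnit (ζ (redN (L * tower L N j) x)))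
          (chart (ContinuousLinearMap.id ℝ (Matrix n n ℂ)) (L * tower L N j) Us (Φ : TDir 4 n (L * tower L N j))))) : ↥(skewSub 4 n (L * tower L N j))) : TDir 4 n (L * tower L N j)))
      = levelQ L N j Us (chart (ContinuousLinearMap.id ℝ (Matrix n n ℂ)) (L * tower L N j) Us (Φ : TDir 4 n (L * tower L N j))) := by
  rw [chart_sliceMap hUsu hUsP hζ Φ hnear]
  show skewPR N (relLog N (cavgIter L (j + 1) Us) (cavgIter L (j + 1) _)) = skewPR N (relLog N (cavgIter L (j + 1) Us) (cavgIter L (j + 1) _))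
  rw [cavgIter_eq_avgIter, cavgIter_eq_avgIter, cavgIter_eq_avgIter, avgIter_gaugeAct_trivialCorner hL hε j hs hΦcl hζ hcorner]

/-! ## §4 (d) Injectivity of the linearised action on trivial-corner fields -/

/-- **(d) `∇̃_W` IS INJECTIVE ON TRIVIAL-CORNER FIELDS**: if `W(b)⁻¹ζ(r)W(b) − ζ(r + e_κ mod M) = 0` for all box bonds and `ζ` vanishes at the corner indices (in particular at the origin), then
`ζ = 0` (`NE7CovariantConstancyBox.eq_zero_of_covariantly_constant` with the conjugation transport). [folklore] -/
theorem covDeriv_injective_trivialCorner {L N : ℕ} [NeZero L] [NeZero N] (j : ℕ) (W : Site 4 → Fin 4 → (Matrix n n ℂ)ˣ)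
    {ζ : (Fin 4 → Fin (L * tower L N j)) → Matrix n n ℂ} (hcorner : ∀ w : Site 4, ζ (redN (L * tower L N j) (((L : ℤ) ^ (j + 1)) • w)) = 0)
    (hcov : ∀ (r : Fin 4 → Fin (L * tower L N j)) (κ : Fin 4),
      (((W (boxVec (L * tower L N j) r) κ)⁻¹ : (Matrix n n ℂ)ˣ) : Matrix n n ℂ) * ζ r * (W (boxVec (L * tower L N j) r) κ : Matrix n n ℂ) - ζ (redN (L * tower L N j) (boxVec (L * tower L N j) r + e κ)) = 0) :
    ζ = 0 := by
  haveI : NeZero (L * tower L N j) := ⟨Nat.mul_ne_zero (NeZero.ne L) (AveragingDeficitMultiLevelPrep.tower_ne_zero L N j)⟩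
  funext r
  have h0 : ζ (fun _ => ⟨0, Nat.pos_of_ne_zero (NeZero.ne (L * tower L N j))⟩) = 0 := by
    have h := hcorner 0
    rw [smul_zero] at h
    have e : redN (L * tower L N j) (0 : Site 4) = fun _ => ⟨0, Nat.pos_of_ne_zero (NeZero.ne (L * tower L N j))⟩ := by
      have h2 := redN_boxVec (L * tower L N j) (fun _ : Fin 4 => (⟨0, Nat.pos_of_ne_zero (NeZero.ne (L * tower L N j))⟩ : Fin (L * tower L N j)))
      have h3 : boxVec (L * tower L N j) (fun _ : Fin 4 => (⟨0, Nat.pos_of_ne_zero (NeZero.ne (L * tower L N j))⟩ : Fin (L * tower L N j))) = (0 : Site 4) := by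
        funext i; simp [boxVec]
      rw [h3] at h2; exact h2
    rw [e] at h; exact h
  refine eq_zero_of_covariantly_constant (L * tower L N j) ζ
    (fun r κ X => (((W (boxVec (L * tower L N j) r) κ)⁻¹ : (Matrix n n ℂ)ˣ) : Matrix n n ℂ) * X * (W (boxVec (L * tower L N j) r) κ : Matrix n n ℂ))
    (fun r κ => by simp) (fun r κ => ?_) h0 r
  have h := hcov r κ
  rw [sub_eq_zero] at h
  exact h.symm

end

end Summit.QuantumFields.BalabanUV.T4Continuum.NE7GaugeSliceMapFacts
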